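import Mathlib.RepresentationTheory.Basic
import Mathlib.Algebra.Group.Subgroup.Pointwise
import Mathlib.Data.List.Chain
import Literature.AlgebraicGeometry.HodgeTheory.LocallyTrivialExtensionClasses

/-!
# Route LinearSystemTorelli — crux `LocalTubeSpan`: the thin configuration — cyclic reduction

Helper file (`--supports stmt-HodgeConjecture-2490`, line `Sketch`, stub `stub_thinClassification`).
The line `Sketch` records a NEGATIVE boundary of the crux's mechanism ("cyclic detection":
injectivity of Schnell's third map `H¹(G, V) → ∏_g V/(g - 1)V`): it FAILS for the thin integral
symplectic transvection configuration `δ₁, δ₂, δ₃ = δ₁ + δ₂`, `⟨δ₁, δ₂⟩ = 4`, on `V = ℚ²`, whose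
three transvections `T₁, T₂, T₃` generate (by ping-pong) a free, thin group with three cusps.

This file is the pure WORD COMBINATORICS of that counterexample — the unipotent/parabolic
classification.  Let a group `G` be generated by three elements `τ 0, τ 1, τ 2` and act on `ℚ²`
by `ρ`, and suppose (the dynamics, hypothesis `hdyn`, proved by ping-pong in the sibling file) that
every CYCLICALLY REDUCED alternating word — a product `∏ (τ i_ℓ) ^ n_ℓ` with all exponents
`n_ℓ ≠ 0`, consecutive letters distinct, and first letter distinct from the last — acts with
`ρ(·) - 1` invertible.  Then EVERY element `g` of `G` either acts with `ρ g - 1` invertible or is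
conjugate to a power `τ i ^ n` of a generator (`localTubeSpan_thinClassification`).

Proof: write `g` as a word (`Subgroup.closure_induction_left`) and induct on its length: a zero
exponent is deleted, two adjacent equal letters are merged, and a reduced alternating word whose
first and last letters coincide is conjugated by its first syllable into a shorter word; both
alternatives of the conclusion are stable under conjugation.  What is left is the empty word, a
single syllable (both conjugate to a generator power), or a cyclically reduced word (`hdyn`).

Role: together with the representation (`stub_thinRep`), the dynamics (`stub_thinDynamics`) and
the undetected non-coboundary (`stub_thinCocycle`) this shows that the multi-orbit form of
C. Schnell, *Primitive cohomology and the tube mapping*, Math. Z. 268 (2010) §7 Prop. 12 — the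
positive statement for (Janssen-complete) vanishing lattices — is false without its
vanishing-lattice hypothesis.  Elementary; no named facts.
-/

-- `Summit.HodgeConjecture.HodgeConjecture.Theorems` is the mandated namespace (single-conjunct summit:
-- Sub = Summit), which `linter.dupNamespace` flags on every declaration; the lakefile turns the
-- linter off tree-wide (weak option), restated here so stand-alone elaboration is warning-free too.
set_option linter.dupNamespace false

noncomputable section

namespace Summit.HodgeConjecture.HodgeConjecture.Theorems

section ThinWords

variable {G : Type} [Group G]

/-- **Words.** In a group generated by `τ 0, τ 1, τ 2` every element is the product of a word
`∏ (τ i_ℓ) ^ n_ℓ`, encoded as a list of syllables `(i_ℓ, n_ℓ) : Fin 3 × ℤ`. [folklore] -/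
theorem localTubeSpan_exists_thinWord (τ : Fin 3 → G)
    (hgen : Subgroup.closure (Set.range τ) = ⊤) (g : G) :
    ∃ L : List (Fin 3 × ℤ), (L.map fun p => τ p.1 ^ p.2).prod = g := by
  have hg : g ∈ Subgroup.closure (Set.range τ) := hgen ▸ Subgroup.mem_top g
  induction hg using Subgroup.closure_induction_left with
  | one => exact ⟨[], by simp⟩
  | mul_left x hx y _ ih =>
    obtain ⟨i, rfl⟩ := hx
    obtain ⟨L, rfl⟩ := ih
    exact ⟨(i, 1) :: L, by simp⟩
  | inv_mul_cancel x hx y _ ih =>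
    obtain ⟨i, rfl⟩ := hx
    obtain ⟨L, rfl⟩ := ih
    exact ⟨(i, -1) :: L, by simp⟩

/-- **Conjugation invariance of the dichotomy.** Both alternatives "`ρ w - 1` is invertible" and
"`w` is conjugate to a generator power" are stable under conjugating `w`: indeed
`ρ (x w x⁻¹) - 1 = ρ x ∘ (ρ w - 1) ∘ ρ x⁻¹`. [folklore] -/
theorem localTubeSpan_thinConjTransfer (ρ : Representation ℚ G (Fin 2 → ℚ)) (τ : Fin 3 → G)
    (x w : G) (hw : IsUnit (ρ w - 1) ∨ ∃ (h : G) (i : Fin 3) (n : ℤ), w = h * τ i ^ n * h⁻¹) :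
    IsUnit (ρ (x * w * x⁻¹) - 1) ∨
      ∃ (h : G) (i : Fin 3) (n : ℤ), x * w * x⁻¹ = h * τ i ^ n * h⁻¹ := by
  rcases hw with hw | ⟨h, i, n, rfl⟩
  · left
    have hx : ρ x * ρ x⁻¹ = 1 := by rw [← map_mul, mul_inv_cancel, map_one]
    have key : ρ (x * w * x⁻¹) - 1 = ρ x * (ρ w - 1) * ρ x⁻¹ := by
      rw [mul_sub, sub_mul, mul_one, hx, map_mul, map_mul]
    rw [key]
    exact (((Group.isUnit x).map ρ).mul hw).mul ((Group.isUnit x⁻¹).map ρ)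
  · right
    exact ⟨x * h, i, n, by group⟩

/-- **Cyclic reduction of words.** If every cyclically reduced alternating word in `τ 0, τ 1, τ 2`
(nonzero exponents, consecutive letters distinct, first letter distinct from the last) acts with
`ρ(·) - 1` invertible, then the product of ANY word either acts with `ρ(·) - 1` invertible or is
conjugate to a generator power `τ i ^ n`.  Strong induction on the length of the word: delete a
zero exponent, merge two adjacent equal letters, or conjugate the first syllable of a reduced word
to its end when the first and last letters coincide. [folklore] -/
theorem localTubeSpan_thinWordClassification (ρ : Representation ℚ G (Fin 2 → ℚ)) (τ : Fin 3 → G)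
    (hdyn : ∀ (L : List (Fin 3 × ℤ)), (∀ p ∈ L, p.2 ≠ 0) → L.IsChain (fun p q => p.1 ≠ q.1) →
      ∀ a b : Fin 3 × ℤ, L.head? = some a → L.getLast? = some b → a.1 ≠ b.1 →
        IsUnit (ρ (L.map fun p => τ p.1 ^ p.2).prod - 1))
    (L : List (Fin 3 × ℤ)) :
    IsUnit (ρ (L.map fun p => τ p.1 ^ p.2).prod - 1) ∨
      ∃ (h : G) (i : Fin 3) (n : ℤ), (L.map fun p => τ p.1 ^ p.2).prod = h * τ i ^ n * h⁻¹ := by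
  induction hN : L.length using Nat.strong_induction_on generalizing L with | _ N ih =>
  -- the induction hypothesis, for every list shorter than `L`
  have IH : ∀ L' : List (Fin 3 × ℤ), L'.length < L.length →
      IsUnit (ρ (L'.map fun p => τ p.1 ^ p.2).prod - 1) ∨
        ∃ (h : G) (i : Fin 3) (n : ℤ), (L'.map fun p => τ p.1 ^ p.2).prod = h * τ i ^ n * h⁻¹ :=
    fun L' hL' => ih L'.length (hL'.trans_eq hN) L' rfl
  clear ih hN
  -- (a) a syllable with exponent zero is deleted
  by_cases hnz : ∀ p ∈ L, p.2 ≠ 0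
  swap
  · push Not at hnz
    obtain ⟨p, hp, hp0⟩ := hnz
    obtain ⟨s, t, rfl⟩ := List.append_of_mem hp
    have key : ((s ++ p :: t).map fun p => τ p.1 ^ p.2).prod =
        ((s ++ t).map fun p => τ p.1 ^ p.2).prod := by
      simp [hp0]
    rw [key]
    exact IH _ (by simp)
  -- (b) two adjacent syllables with the same letter are merged
  by_cases hchain : L.IsChain (fun p q => p.1 ≠ q.1)
  swap
  · rw [List.isChain_iff_forall_rel_of_append_cons_cons] at hchain
    push Not at hchain
    obtain ⟨p, q, s, t, rfl, hpq⟩ := hchain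
    have key : ((s ++ p :: q :: t).map fun p => τ p.1 ^ p.2).prod =
        ((s ++ (q.1, p.2 + q.2) :: t).map fun p => τ p.1 ^ p.2).prod := by
      simp [hpq, zpow_add, mul_assoc]
    rw [key]
    exact IH _ (by simp)
  -- (c) `L` is an alternating word with nonzero exponents
  cases L with
  | nil => exact Or.inr ⟨1, 0, 0, by simp⟩
  | cons a M' =>
    rcases M'.eq_nil_or_concat' with rfl | ⟨M, b, rfl⟩
    · exact Or.inr ⟨1, a.1, a.2, by simp⟩
    by_cases hab : a.1 = b.1
    · -- first and last letters coincide: conjugate the first syllable to the end and merge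
      have key : ((a :: (M ++ [b])).map fun p => τ p.1 ^ p.2).prod =
          τ a.1 ^ a.2 * ((M ++ [(b.1, b.2 + a.2)]).map fun p => τ p.1 ^ p.2).prod *
            (τ a.1 ^ a.2)⁻¹ := by
        simp [hab, zpow_add, mul_assoc]
      rw [key]
      exact localTubeSpan_thinConjTransfer ρ τ _ _ (IH _ (by simp))
    · -- a cyclically reduced word: the dynamics
      exact Or.inl (hdyn _ hnz hchain a b rfl
        (by rw [← List.cons_append]; exact List.getLast?_concat) hab)

end ThinWords

/-- **The thin classification (stub `stub_thinClassification` of the line `Sketch`).** Let `G` be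
generated by `τ 0, τ 1, τ 2` and act on `ℚ²` by `ρ`, and suppose that every cyclically reduced
alternating word `∏ (τ i_ℓ) ^ n_ℓ` (all `n_ℓ ≠ 0`, consecutive letters distinct, first letter
distinct from the last) acts with `ρ(·) - 1` invertible.  Then every `g : G` either acts with
`ρ g - 1` invertible or is conjugate to a power of a generator.  (For the three transvections of
the thin configuration this is the unipotent/parabolic dichotomy of a free Fuchsian group with
three cusps.) [folklore] -/
theorem localTubeSpan_thinClassification {G : Type} [Group G] (ρ : Representation ℚ G (Fin 2 → ℚ))
    (τ : Fin 3 → G) (hgen : Subgroup.closure (Set.range τ) = ⊤)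
    (hdyn : ∀ (L : List (Fin 3 × ℤ)), (∀ p ∈ L, p.2 ≠ 0) → L.IsChain (fun p q => p.1 ≠ q.1) →
      ∀ a b : Fin 3 × ℤ, L.head? = some a → L.getLast? = some b → a.1 ≠ b.1 →
        IsUnit (ρ (L.map fun p => τ p.1 ^ p.2).prod - 1))
    (g : G) :
    IsUnit (ρ g - 1) ∨ ∃ (h : G) (i : Fin 3) (n : ℤ), g = h * τ i ^ n * h⁻¹ := by
  obtain ⟨L, rfl⟩ := localTubeSpan_exists_thinWord τ hgen g
  exact localTubeSpan_thinWordClassification ρ τ hdyn L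

end Summit.HodgeConjecture.HodgeConjecture.Theorems

end
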